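import Literature.MathematicalPhysics.KineticTheory.LangevinChainSDE
import Literature.Probability.Process.BrownianPair
import Literature.Probability.Process.PathRegularization
import Mathlib.Probability.Kernel.Composition.Comp
import HarnessLib

/-!
# The transition kernels of the Langevin-driven pinned chain: construction, Feller property, Chapman–Kolmogorov

Trunk T-KINETIC (Literature/MathematicalPhysics/KineticTheory). Fourth decomposition step for the
named fact `CuneoEckmannHairerReyBellet2018_pinnedChain` (`LangevinChainNESS.lean`; provefact unit
`Literature.MathematicalPhysics.KineticTheory.HeatConduction.CuneoEckmannHairerReyBellet2018_pinnedChain`).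
After `LangevinChainHormander.lean` the fact rests on Hörmander's theorem and on the Lyapunov /
semigroup fact `CuneoEckmannHairerReyBellet2018_lyapunov` (`LangevinChainLyapunov.lean`): "there is
a Feller `LangevinChainSemigroup` of the pinned chain satisfying (3.4) and H2". The bound (3.4) is
proved for every such semigroup in `LangevinChainExpBound.lean`; what is missing is the
CONSTRUCTION of the transition semigroup of the SDE (2.2) (Cuneo–Eckmann–Hairer–Rey-Bellet 2018,
eq. (2.3): "`P_t(z, A) = P_z{z_t ∈ A}`"; §3 p. 7: "the process admits strong solutions … the
strong Markov property is satisfied"; p. 9: "the process is Feller") and the Lyapunov estimate H2.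
This file constructs the transition KERNELS from the pathwise flow `OscillatorChain.chainFlow` of
`LangevinChainSDE.lean` driven by the pair of independent Brownian motions of
`Literature/Probability/Process/BrownianPair.lean`, and proves everything of the interface
`LangevinChainSemigroup` except the Dynkin identity (Itô's formula on `C_c^∞`, the next step):

* `chainNoise N c_L c_R w` — the momentum-noise path `η_i(t) = [i=0] c_L (w̄₁(t⁺) - w̄₁(0)) +
  [i=N-1] c_R (w̄₂(t⁺) - w̄₂(0))` of a pair of RAW paths `w`, through the measurable regularisation
  `w̄ = pathRegularize w` (`PathRegularization.lean`, the identity on continuous paths): continuous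
  in `t` for every `w`, measurable in `w`; on the Brownian pair `pairPath ω` it is
  `[i=0] c_L B¹_{t⁺} + [i=N-1] c_R B²_{t⁺}` (`chainNoise_pairPath`), and the noise of the shifted
  pair `pairShift s ω` is the shifted noise (`chainNoise_pairShift`).
* `OscillatorChain.solMap P N T_L T_R t x w` — the solution map `Φ_t(x, w) = chainFlow x η(w) t`
  with the amplitudes `c_b = √(2γT_b)` of (2.2); for the pinned chain (`ω₂ > 0`, `lam, β, γ ≥ 0`):
  jointly measurable in `(t, x, w)`, continuous in `t` and in `x`, `Φ_0 = id`, and the COCYCLE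
  through the shift of the pair, `Φ_{s+t}(x, B(ω)) = Φ_t(Φ_s(x, B(ω)), θ_s ω)`
  (`pinnedChain_solMap_add_pairPath`).
* `OscillatorChain.transitionKernel P N T_L T_R t` — the transition kernel
  `P_t(x, ·) = law(Φ_t(x, B))`, `B = pairPath` under `wienerPair` (documented junk: the zero kernel
  when the solution map is not measurable, never the case for the pinned chain,
  `pinnedChain_transitionKernel_apply`). For the pinned chain: Markov kernels
  (`pinnedChain_isMarkovKernel_transitionKernel`), jointly measurable in `(t, x)`
  (`pinnedChain_measurable_transitionKernel`), `P_0 = id` (`pinnedChain_transitionKernel_zero`),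
  `P^t g(x) = E g(Φ_t(x, B))` (`pinnedChain_(l)integral_transitionKernel`), the same law in raw path
  coordinates (`pinnedChain_transitionKernel_eq_map_solMap`).
* `pinnedChain_continuous_integral_transitionKernel(_bcf)` — **the Feller property**, PROVED:
  `x ↦ P^t g(x)` is continuous for bounded continuous `g` (continuity of the flow in the initial
  condition + dominated convergence).
* `pinnedChain_measurable_comap_pairPast_solMap` — `Φ_s(x, B)` is measurable with respect to the
  past `σ(B_u : u ≤ s)` of the pair (the flow on `[0, s]` is driven by the noise stopped at `s`).
* `pinnedChain_transitionKernel_add` — **the Chapman–Kolmogorov equation `P_{s+t} = P_t ∘ P_s`,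
  PROVED** from the cocycle property and the weak Markov property of the Brownian pair
  (`Literature.Probability.Process.lintegral_comp_pairShift_eq`).

So after this file the semigroup part of `CuneoEckmannHairerReyBellet2018_lyapunov` is reduced to
the Dynkin identity `P_t f(x) - f(x) = ∫₀ᵗ P_s(Lf)(x) ds` on `C_c^∞` for these kernels (then
`LangevinChainExpBound.lean` supplies (3.4) and this file the Feller property), and to H2 (CEHR
Thm 5.1).

## References

* N. Cuneo, J.-P. Eckmann, M. Hairer, L. Rey-Bellet, *Non-equilibrium steady states for networks
  of oscillators*, Electron. J. Probab. 23 (2018) no. 55 (arXiv:1712.09413): §2 eq. (2.2), (2.3),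
  §3 p. 7 (strong solutions, Markov property), p. 9 / §3.3 ("the process is Feller"). Page numbers
  refer to the arXiv version.
* D. Revuz, M. Yor, *Continuous Martingales and Brownian Motion* (3rd ed., 1999), Ch. III §1
  (simple Markov property), Ch. IX §1 (pathwise uniqueness and the flow of an SDE).
* R. Khasminskii, *Stochastic Stability of Differential Equations* (2nd ed., 2012), §3.4
  (regular SDE solutions form a Feller Markov process).

## Design choices

* The noise is a functional of RAW pairs of paths through `pathRegularize`, so that the solution
  map is an honest jointly measurable functional on `PhaseSpace N × WienerPair` to which the Markov
  factorisation `lintegral_comp_pairShift_eq` applies verbatim, while on the (continuous) Brownian,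
  shifted-Brownian and stopped-Brownian pairs it is the honest noise. Subtracting the value at `0`
  makes `η(0) = 0` and `Φ_0 = id` hold for every raw pair.
* Noise amplitudes enter `chainNoise` as parameters `c_L, c_R`; `solMap` fixes them to
  `√(2γT_L), √(2γT_R)` (for `γT_b < 0` the square root is the junk `0`; the semigroup facts assume
  `γ, T_L, T_R > 0`). For `N = 1` both amplitudes act on the single site (two independent noises of
  total intensity `2γ(T_L + T_R)`), matching `OscillatorChain.generator`.
* Time is real for the flow (`chainFlow`, clamped on `(-∞, 0]`) and `ℝ≥0` for the kernels, as in
  `LangevinChainSemigroup`.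
* Elaboration note: `Measurable.comp` terms involving `solMap` are built with `have` and closed by
  `exact` — elaborating them against the expected type makes the unifier unfold the flow.
-/

noncomputable section

open MeasureTheory ProbabilityTheory Filter Topology Set
open scoped NNReal ENNReal

namespace Literature.MathematicalPhysics.KineticTheory.HeatConduction

open Literature.Probability.Process OscillatorChain

variable {N : ℕ}

/-! ### The momentum-noise path of a pair of driving paths -/

/-- The **momentum-noise path** of the chain driven by the pair of raw paths `w = (w₁, w₂)`:
`η_i(t) = [i = 0] c_L (w̄₁(t⁺) - w̄₁(0)) + [i = N-1] c_R (w̄₂(t⁺) - w̄₂(0))` (weights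
`[i = 0], [i = N-1] ∈ {0, 1}` written as `if … then c else 0` factors), where `w̄ = pathRegularize w`
is the measurable regularisation of `PathRegularization.lean` (the identity on continuous paths),
`t⁺ = max(t, 0)`, and `c_L, c_R` are the noise amplitudes (`√(2γT_L)`, `√(2γT_R)` for CEHR (2.2)).
Continuous in `t` for EVERY `w`, jointly measurable, `η(0) = 0`. [folklore] -/
def chainNoise (N : ℕ) (c_L c_R : ℝ) (w : WienerPair) (t : ℝ) : Fin N → ℝ := fun i =>
  (if i.val = 0 then c_L else 0) * (pathRegularize w.1 t.toNNReal - pathRegularize w.1 0) +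
    (if i.val = N - 1 then c_R else 0) * (pathRegularize w.2 t.toNNReal - pathRegularize w.2 0)

section Noise

variable (c_L c_R : ℝ)

/-- `η(0) = 0`. [folklore] -/
@[simp] theorem chainNoise_zero (w : WienerPair) : chainNoise N c_L c_R w 0 = 0 := by
  funext i
  simp [chainNoise]

/-- `η(t) = η(0) = 0` for `t ≤ 0`. [folklore] -/
theorem chainNoise_of_nonpos (w : WienerPair) {t : ℝ} (ht : t ≤ 0) : chainNoise N c_L c_R w t = 0 := by
  funext i
  simp [chainNoise, Real.toNNReal_of_nonpos ht]

/-- The noise path is continuous in time, for every pair of raw paths. [folklore] -/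
theorem continuous_chainNoise (w : WienerPair) : Continuous (chainNoise N c_L c_R w) := by
  refine continuous_pi fun i => ?_
  have h1 := continuous_pathRegularize_toNNReal (E := ℝ) w.1
  have h2 := continuous_pathRegularize_toNNReal (E := ℝ) w.2
  unfold chainNoise
  fun_prop

/-- The noise path at a fixed time is a measurable function of the pair of raw paths. [folklore] -/
@[fun_prop]
theorem measurable_chainNoise (t : ℝ) : Measurable fun w : WienerPair => chainNoise N c_L c_R w t := by
  refine measurable_pi_iff.2 fun i => ?_
  unfold chainNoise
  have h1 : ∀ u : ℝ≥0, Measurable fun w : WienerPair => pathRegularize w.1 u := fun u =>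
    (measurable_pathRegularize u).comp measurable_fst
  have h2 : ∀ u : ℝ≥0, Measurable fun w : WienerPair => pathRegularize w.2 u := fun u =>
    (measurable_pathRegularize u).comp measurable_snd
  fun_prop

/-- On a pair of CONTINUOUS paths the noise is read off the paths themselves:
`η_i(t) = [i=0] c_L (w₁(t⁺) - w₁(0)) + [i=N-1] c_R (w₂(t⁺) - w₂(0))`. [folklore] -/
theorem chainNoise_of_continuous {w : WienerPair} (h1 : Continuous w.1) (h2 : Continuous w.2)
    (t : ℝ) (i : Fin N) :
    chainNoise N c_L c_R w t i =
      (if i.val = 0 then c_L else 0) * (w.1 t.toNNReal - w.1 0) +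
        (if i.val = N - 1 then c_R else 0) * (w.2 t.toNNReal - w.2 0) := by
  simp only [chainNoise, pathRegularize_eq_self_of_continuous h1,
    pathRegularize_eq_self_of_continuous h2]

/-- The noise of the pair of Brownian paths `pairPath ω`:
`η_i(t) = [i=0] c_L B_{t⁺}(ω₁) + [i=N-1] c_R B_{t⁺}(ω₂)`. [folklore] -/
theorem chainNoise_pairPath (ω : WienerPair) (t : ℝ) (i : Fin N) :
    chainNoise N c_L c_R (pairPath ω) t i =
      (if i.val = 0 then c_L else 0) * brownian t.toNNReal ω.1 +
        (if i.val = N - 1 then c_R else 0) * brownian t.toNNReal ω.2 := by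
  rw [chainNoise_of_continuous c_L c_R (continuous_pairPath_fst ω) (continuous_pairPath_snd ω)]
  simp [pairPath]

/-- The noise of the shifted pair `pairShift s ω` is the shifted noise of `pairPath ω` on `t ≥ 0`:
`η(θ_s ω)(t) = η(ω)(s + t) - η(ω)(s)`. [folklore] -/
theorem chainNoise_pairShift (s : ℝ≥0) (ω : WienerPair) {t : ℝ} (ht : 0 ≤ t) :
    chainNoise N c_L c_R (pairShift s ω) t =
      chainNoise N c_L c_R (pairPath ω) (s + t) - chainNoise N c_L c_R (pairPath ω) s := by
  funext i
  rw [Pi.sub_apply, chainNoise_of_continuous c_L c_R (continuous_pairShift_fst (s := s) ω)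
    (continuous_pairShift_snd (s := s) ω), chainNoise_pairPath, chainNoise_pairPath]
  have hst : ((s : ℝ) + t).toNNReal = s + t.toNNReal := by
    rw [Real.toNNReal_add s.coe_nonneg ht, Real.toNNReal_coe]
  simp only [pairShift, hst, Real.toNNReal_coe, add_zero, sub_self]
  ring

end Noise


/-! ### The solution map of the chain driven by a pair of paths -/

namespace OscillatorChain

variable (P : OscillatorChain)

/-- The **solution map** `Φ_t(x, w)` of the chain `P` with `N` sites and bath temperatures
`T_L, T_R`: the pathwise solution `chainFlow` (`LangevinChainSDE.lean`) at time `t`, started at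
`x`, driven by the momentum noise `chainNoise` of the pair of raw paths `w` with the amplitudes
`c_L = √(2γT_L)`, `c_R = √(2γT_R)` of the SDE (2.2),
`dp_b = … - γ p_b dt + √(2γT_b) dW_b`. [cite: CuneoEckmannHairerReyBellet2018, §2 eq. (2.2)] -/
def solMap (N : ℕ) (T_L T_R : ℝ) (t : ℝ) (x : PhaseSpace N) (w : WienerPair) : PhaseSpace N :=
  P.chainFlow N x (chainNoise N (Real.sqrt (2 * P.γ * T_L)) (Real.sqrt (2 * P.γ * T_R)) w) t

open Classical in
/-- The **transition kernel** `P_t(x, ·) = law of Φ_t(x, B)` of the chain, `B = pairPath ω` the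
pair of independent Brownian paths under `wienerPair` (CEHR (2.3): "`P_t(z, A) = P_z{z_t ∈ A}`").
**Junk value**: the zero kernel if the solution map is not jointly measurable in `(x, ω)` — never
the case for the pinned chain (`pinnedChain_transitionKernel_apply`).
[cite: CuneoEckmannHairerReyBellet2018, eq. (2.3)] -/
def transitionKernel (N : ℕ) (T_L T_R : ℝ) (t : ℝ≥0) : Kernel (PhaseSpace N) (PhaseSpace N) :=
  if h : Measurable fun p : PhaseSpace N × WienerPair => P.solMap N T_L T_R t p.1 (pairPath p.2) then
    { toFun := fun x => wienerPair.map fun ω => P.solMap N T_L T_R t x (pairPath ω)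
      measurable' := by
        refine Measure.measurable_of_measurable_coe _ fun A hA => ?_
        have hx : (fun x => (wienerPair.map fun ω => P.solMap N T_L T_R t x (pairPath ω)) A) =
            fun x => wienerPair (Prod.mk x ⁻¹'
              ((fun p : PhaseSpace N × WienerPair => P.solMap N T_L T_R t p.1 (pairPath p.2)) ⁻¹' A)) := by
          funext x
          have hx := h.comp (measurable_prodMk_left (x := x))
          have hx' : Measurable fun ω => P.solMap N T_L T_R t x (pairPath ω) := hx
          rw [Measure.map_apply hx' hA]
          rfl
        rw [hx]
        exact measurable_measure_prodMk_left (h hA) }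
  else 0

end OscillatorChain

/-! ### The pinned chain: measurability and continuity of the solution map -/

section Pinned

variable {ω₂ lam β γ : ℝ} (hω : 0 < ω₂) (hl : 0 ≤ lam) (hβ : 0 ≤ β) (hγ : 0 ≤ γ) (N : ℕ)
  (T_L T_R : ℝ)
include hω hl hβ hγ

/-- The solution map is jointly measurable in `(x, w)` (parametric measurability of the flow,
`pinnedChain_measurable_chainFlow`, the noise being continuous in time for EVERY pair of raw
paths). [folklore] -/
theorem pinnedChain_measurable_solMap (t : ℝ) :
    Measurable fun p : PhaseSpace N × WienerPair => (pinnedChain ω₂ lam β γ).solMap N T_L T_R t p.1 p.2 := by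
  unfold OscillatorChain.solMap
  exact pinnedChain_measurable_chainFlow hω hl hβ hγ N (X := fun p : PhaseSpace N × WienerPair => p.1)
    (G := fun p : PhaseSpace N × WienerPair => chainNoise N (Real.sqrt (2 * (pinnedChain ω₂ lam β γ).γ * T_L))
      (Real.sqrt (2 * (pinnedChain ω₂ lam β γ).γ * T_R)) p.2)
    measurable_fst (fun p => continuous_chainNoise _ _ p.2)
    (fun u => (measurable_chainNoise _ _ u).comp measurable_snd) t

/-- The solution map driven by the Brownian pair is jointly measurable in `(x, ω)`. [folklore] -/
theorem pinnedChain_measurable_solMap_pairPath (t : ℝ) :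
    Measurable fun p : PhaseSpace N × WienerPair =>
      (pinnedChain ω₂ lam β γ).solMap N T_L T_R t p.1 (pairPath p.2) := by
  -- NB: elaborating `Measurable.comp` AGAINST the expected type makes the unifier unfold
  -- `solMap`/`chainFlow` (time-out); build the term first, then `exact`.
  have h2 : Measurable fun p : PhaseSpace N × WienerPair => (p.1, pairPath p.2) :=
    measurable_fst.prodMk (measurable_pairPath.comp measurable_snd)
  have h := (pinnedChain_measurable_solMap hω hl hβ hγ N T_L T_R t).comp h2
  exact h

/-- For fixed `x`, `ω ↦ Φ_t(x, pairPath ω)` is measurable. [folklore] -/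
theorem pinnedChain_measurable_solMap_pairPath_right (t : ℝ) (x : PhaseSpace N) :
    Measurable fun ω : WienerPair => (pinnedChain ω₂ lam β γ).solMap N T_L T_R t x (pairPath ω) := by
  have h := (pinnedChain_measurable_solMap_pairPath hω hl hβ hγ N T_L T_R t).comp
    (measurable_prodMk_left (x := x))
  exact h

/-- The solution map is continuous in time. [folklore] -/
theorem pinnedChain_continuous_solMap (x : PhaseSpace N) (w : WienerPair) :
    Continuous fun t => (pinnedChain ω₂ lam β γ).solMap N T_L T_R t x w := by
  unfold OscillatorChain.solMap
  exact pinnedChain_continuous_chainFlow hω hl hβ hγ N x (continuous_chainNoise _ _ w)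

/-- The solution map is continuous in the initial condition. [folklore] -/
theorem pinnedChain_continuous_solMap_left (t : ℝ) (w : WienerPair) :
    Continuous fun x => (pinnedChain ω₂ lam β γ).solMap N T_L T_R t x w := by
  unfold OscillatorChain.solMap
  exact pinnedChain_continuous_chainFlow_left hω hl hβ hγ N (continuous_chainNoise _ _ w) t

/-- The solution map is jointly measurable in `(t, x, w)` (continuous in `t`, measurable in
`(x, w)`). [folklore] -/
theorem pinnedChain_measurable_uncurry_solMap :
    Measurable fun p : ℝ × (PhaseSpace N × WienerPair) =>
      (pinnedChain ω₂ lam β γ).solMap N T_L T_R p.1 p.2.1 p.2.2 := by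
  have h := measurable_uncurry_of_continuous_of_measurable
    (u := fun (t : ℝ) (p : PhaseSpace N × WienerPair) => (pinnedChain ω₂ lam β γ).solMap N T_L T_R t p.1 p.2)
    (fun p => pinnedChain_continuous_solMap hω hl hβ hγ N T_L T_R p.1 p.2)
    (pinnedChain_measurable_solMap hω hl hβ hγ N T_L T_R)
  exact h

omit hω hl hβ hγ in
/-- At time `0` (and before) the solution map is the initial condition: `Φ_t(x, w) = x` for
`t ≤ 0` (the noise vanishes at `0`). [folklore] -/
theorem pinnedChain_solMap_of_nonpos (x : PhaseSpace N) (w : WienerPair) {t : ℝ} (ht : t ≤ 0) :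
    (pinnedChain ω₂ lam β γ).solMap N T_L T_R t x w = x := by
  unfold OscillatorChain.solMap
  rw [pinnedChain_chainFlow_of_nonpos ω₂ lam β γ N x (continuous_chainNoise _ _ w) ht, chainNoise_zero]
  simp

/-- **The cocycle property through the shift of the Brownian pair**: for `s, t ≥ 0`,
`Φ_{s+t}(x, B(ω)) = Φ_t(Φ_s(x, B(ω)), θ_s ω)` with `θ_s ω = pairShift s ω` the pair of shifted
paths (`pinnedChain_chainFlow_add` + `chainNoise_pairShift`). [folklore] -/
theorem pinnedChain_solMap_add_pairPath (s : ℝ≥0) {t : ℝ} (ht : 0 ≤ t) (x : PhaseSpace N) (ω : WienerPair) :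
    (pinnedChain ω₂ lam β γ).solMap N T_L T_R (s + t) x (pairPath ω) =
      (pinnedChain ω₂ lam β γ).solMap N T_L T_R t
        ((pinnedChain ω₂ lam β γ).solMap N T_L T_R s x (pairPath ω)) (pairShift s ω) := by
  unfold OscillatorChain.solMap
  rw [pinnedChain_chainFlow_add hω hl hβ hγ N x (continuous_chainNoise _ _ _) s.coe_nonneg ht]
  refine pinnedChain_chainFlow_congr hω hl hβ hγ N _ ?_ (continuous_chainNoise _ _ _)
    (fun r hr => (chainNoise_pairShift _ _ s ω hr.1).symm) ⟨ht, le_rfl⟩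
  exact ((continuous_chainNoise _ _ _).comp (continuous_const_add _)).sub continuous_const

end Pinned


/-! ### The transition kernels of the pinned chain -/

section PinnedKernel

variable {ω₂ lam β γ : ℝ} (hω : 0 < ω₂) (hl : 0 ≤ lam) (hβ : 0 ≤ β) (hγ : 0 ≤ γ) (N : ℕ)
  (T_L T_R : ℝ)
include hω hl hβ hγ

/-- **The transition kernel of the pinned chain is the law of the solution map driven by the
Brownian pair**: `P_t(x, ·) = law(Φ_t(x, B))` (no junk). [cite: CuneoEckmannHairerReyBellet2018, eq. (2.3)] -/
theorem pinnedChain_transitionKernel_apply (t : ℝ≥0) (x : PhaseSpace N) :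
    (pinnedChain ω₂ lam β γ).transitionKernel N T_L T_R t x =
      wienerPair.map fun ω => (pinnedChain ω₂ lam β γ).solMap N T_L T_R t x (pairPath ω) := by
  rw [OscillatorChain.transitionKernel,
    dif_pos (pinnedChain_measurable_solMap_pairPath hω hl hβ hγ N T_L T_R t)]
  rfl

/-- `P_t(x, A) = P{Φ_t(x, B) ∈ A}`. [cite: CuneoEckmannHairerReyBellet2018, eq. (2.3)] -/
theorem pinnedChain_transitionKernel_apply' (t : ℝ≥0) (x : PhaseSpace N) {A : Set (PhaseSpace N)}
    (hA : MeasurableSet A) :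
    (pinnedChain ω₂ lam β γ).transitionKernel N T_L T_R t x A =
      wienerPair ((fun ω => (pinnedChain ω₂ lam β γ).solMap N T_L T_R t x (pairPath ω)) ⁻¹' A) := by
  rw [pinnedChain_transitionKernel_apply hω hl hβ hγ,
    Measure.map_apply (pinnedChain_measurable_solMap_pairPath_right hω hl hβ hγ N T_L T_R t x) hA]

/-- `P^t g(x) = E g(Φ_t(x, B))` for measurable `g ≥ 0` (Lebesgue integral).
[cite: CuneoEckmannHairerReyBellet2018, §3 p. 7] -/
theorem pinnedChain_lintegral_transitionKernel (t : ℝ≥0) (x : PhaseSpace N) {g : PhaseSpace N → ℝ≥0∞}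
    (hg : Measurable g) :
    ∫⁻ y, g y ∂((pinnedChain ω₂ lam β γ).transitionKernel N T_L T_R t x) =
      ∫⁻ ω, g ((pinnedChain ω₂ lam β γ).solMap N T_L T_R t x (pairPath ω)) ∂wienerPair := by
  rw [pinnedChain_transitionKernel_apply hω hl hβ hγ,
    lintegral_map hg (pinnedChain_measurable_solMap_pairPath_right hω hl hβ hγ N T_L T_R t x)]

/-- `P^t g(x) = E g(Φ_t(x, B))` for (ae-strongly) measurable real `g` (Bochner integral; both sides
are junk `0` together when `g ∘ Φ_t(x, B)` is not integrable).
[cite: CuneoEckmannHairerReyBellet2018, §3 p. 7] -/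
theorem pinnedChain_integral_transitionKernel (t : ℝ≥0) (x : PhaseSpace N) {g : PhaseSpace N → ℝ}
    (hg : AEStronglyMeasurable g ((pinnedChain ω₂ lam β γ).transitionKernel N T_L T_R t x)) :
    ∫ y, g y ∂((pinnedChain ω₂ lam β γ).transitionKernel N T_L T_R t x) =
      ∫ ω, g ((pinnedChain ω₂ lam β γ).solMap N T_L T_R t x (pairPath ω)) ∂wienerPair := by
  rw [pinnedChain_transitionKernel_apply hω hl hβ hγ] at hg ⊢
  rw [integral_map (pinnedChain_measurable_solMap_pairPath_right hω hl hβ hγ N T_L T_R t x).aemeasurable hg]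

/-- The transition kernels are Markov (probability) kernels: no explosion.
[cite: CuneoEckmannHairerReyBellet2018, §3 p. 7] -/
theorem pinnedChain_isMarkovKernel_transitionKernel (t : ℝ≥0) :
    IsMarkovKernel ((pinnedChain ω₂ lam β γ).transitionKernel N T_L T_R t) := by
  refine ⟨fun x => ?_⟩
  rw [pinnedChain_transitionKernel_apply hω hl hβ hγ]
  exact Measure.isProbabilityMeasure_map
    (pinnedChain_measurable_solMap_pairPath_right hω hl hβ hγ N T_L T_R t x).aemeasurable

/-- The law of `Φ_t(x, ·)` under `wienerPair` in RAW path coordinates is the same kernel (the pair of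
Brownian paths has law `wienerPair`, `map_pairPath_wienerPair`). [folklore] -/
theorem pinnedChain_transitionKernel_eq_map_solMap (t : ℝ≥0) (x : PhaseSpace N) :
    (pinnedChain ω₂ lam β γ).transitionKernel N T_L T_R t x =
      wienerPair.map ((pinnedChain ω₂ lam β γ).solMap N T_L T_R t x) := by
  have h1 : Measurable ((pinnedChain ω₂ lam β γ).solMap N T_L T_R t x) := by
    have h := (pinnedChain_measurable_solMap hω hl hβ hγ N T_L T_R t).comp
      (measurable_prodMk_left (x := x))
    exact h
  rw [pinnedChain_transitionKernel_apply hω hl hβ hγ]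
  change Measure.map ((pinnedChain ω₂ lam β γ).solMap N T_L T_R t x ∘ pairPath) wienerPair = _
  rw [← Measure.map_map h1 measurable_pairPath, map_pairPath_wienerPair]

/-- **Joint measurability** of `(t, x) ↦ P_t(x, ·)` (the solution map is jointly measurable in
`(t, x, ω)`): the transition kernels form a measurable Markov semigroup. [folklore] -/
theorem pinnedChain_measurable_transitionKernel :
    Measurable fun p : ℝ≥0 × PhaseSpace N => (pinnedChain ω₂ lam β γ).transitionKernel N T_L T_R p.1 p.2 := by
  set F : (ℝ≥0 × PhaseSpace N) × WienerPair → PhaseSpace N := fun q =>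
    (pinnedChain ω₂ lam β γ).solMap N T_L T_R q.1.1 q.1.2 (pairPath q.2) with hF
  have hFm : Measurable F := by
    have h1 : Measurable fun q : (ℝ≥0 × PhaseSpace N) × WienerPair =>
        ((q.1.1 : ℝ), (q.1.2, pairPath q.2)) :=
      (measurable_coe_nnreal_real.comp (measurable_fst.comp measurable_fst)).prodMk
        ((measurable_snd.comp measurable_fst).prodMk (measurable_pairPath.comp measurable_snd))
    have h := (pinnedChain_measurable_uncurry_solMap hω hl hβ hγ N T_L T_R).comp h1
    exact h
  refine Measure.measurable_of_measurable_coe _ fun A hA => ?_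
  have h : (fun p : ℝ≥0 × PhaseSpace N => (pinnedChain ω₂ lam β γ).transitionKernel N T_L T_R p.1 p.2 A) =
      fun p => wienerPair (Prod.mk p ⁻¹' (F ⁻¹' A)) := by
    funext p
    rw [pinnedChain_transitionKernel_apply' hω hl hβ hγ N T_L T_R p.1 p.2 hA]
    rfl
  rw [h]
  exact measurable_measure_prodMk_left (hFm hA)

/-- `P_0 = id`: `Φ_0(x, B) = x`. [folklore] -/
theorem pinnedChain_transitionKernel_zero :
    (pinnedChain ω₂ lam β γ).transitionKernel N T_L T_R 0 = Kernel.id := by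
  refine Kernel.ext fun x => ?_
  rw [pinnedChain_transitionKernel_apply hω hl hβ hγ, Kernel.id_apply]
  have h : (fun ω : WienerPair => (pinnedChain ω₂ lam β γ).solMap N T_L T_R ((0 : ℝ≥0) : ℝ) x (pairPath ω)) =
      fun _ => x := funext fun ω => pinnedChain_solMap_of_nonpos N T_L T_R x _ (by simp)
  rw [h, Measure.map_const, measure_univ, one_smul]

/-- **The Feller property**: `x ↦ P^t g(x) = E g(Φ_t(x, B))` is continuous for bounded continuous `g`
(continuity of the flow in the initial condition and dominated convergence; CEHR p. 9: "the
process is Feller"). [cite: CuneoEckmannHairerReyBellet2018, §3.3] -/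
theorem pinnedChain_continuous_integral_transitionKernel (t : ℝ≥0) {g : PhaseSpace N → ℝ}
    (hg : Continuous g) {C : ℝ} (hC : ∀ y, ‖g y‖ ≤ C) :
    Continuous fun x => ∫ y, g y ∂((pinnedChain ω₂ lam β γ).transitionKernel N T_L T_R t x) := by
  have h : (fun x => ∫ y, g y ∂((pinnedChain ω₂ lam β γ).transitionKernel N T_L T_R t x)) =
      fun x => ∫ ω, g ((pinnedChain ω₂ lam β γ).solMap N T_L T_R t x (pairPath ω)) ∂wienerPair := by
    funext x
    exact pinnedChain_integral_transitionKernel hω hl hβ hγ N T_L T_R t x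
      hg.aestronglyMeasurable
  rw [h]
  refine continuous_of_dominated (bound := fun _ => C) (fun x => ?_) (fun x => ?_)
    (integrable_const C) ?_
  · exact (hg.measurable.comp
      (pinnedChain_measurable_solMap_pairPath_right hω hl hβ hγ N T_L T_R t x)).aestronglyMeasurable
  · exact Eventually.of_forall fun ω => hC _
  · exact Eventually.of_forall fun ω =>
      hg.comp (pinnedChain_continuous_solMap_left hω hl hβ hγ N T_L T_R t (pairPath ω))

/-- The Feller property for `g : PhaseSpace N →ᵇ ℝ`. [cite: CuneoEckmannHairerReyBellet2018, §3.3] -/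
theorem pinnedChain_continuous_integral_transitionKernel_bcf (t : ℝ≥0) (g : BoundedContinuousFunction (PhaseSpace N) ℝ) :
    Continuous fun x => ∫ y, g y ∂((pinnedChain ω₂ lam β γ).transitionKernel N T_L T_R t x) :=
  pinnedChain_continuous_integral_transitionKernel hω hl hβ hγ N T_L T_R t g.continuous
    (fun y => g.norm_coe_le_norm y)

end PinnedKernel


/-! ### The Chapman–Kolmogorov equation -/

section ChapmanKolmogorov

variable {ω₂ lam β γ : ℝ} (hω : 0 < ω₂) (hl : 0 ≤ lam) (hβ : 0 ≤ β) (hγ : 0 ≤ γ) (N : ℕ)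
  (T_L T_R : ℝ)
include hω hl hβ hγ

/-- **The solution at time `s` is measurable with respect to the past of the Brownian pair up to
time `s`** (`σ(pairPast s)`): it is the flow driven by the noise STOPPED at `s`, which is a
continuous path read off `pairPast s ω`, and the flow on `[0, s]` only sees the noise on `[0, s]`.
[folklore] -/
theorem pinnedChain_measurable_comap_pairPast_solMap (s : ℝ≥0) (x : PhaseSpace N) :
    Measurable[MeasurableSpace.comap (pairPast s) inferInstance]
      fun ω : WienerPair => (pinnedChain ω₂ lam β γ).solMap N T_L T_R s x (pairPath ω) := by
  -- the stopped noise `u ↦ η(min u s)`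
  set G : WienerPair → ℝ → Fin N → ℝ := fun ω u =>
    chainNoise N (Real.sqrt (2 * (pinnedChain ω₂ lam β γ).γ * T_L))
      (Real.sqrt (2 * (pinnedChain ω₂ lam β γ).γ * T_R)) (pairPath ω) (min u s) with hG
  have hGc : ∀ ω, Continuous (G ω) := fun ω =>
    (continuous_chainNoise _ _ (pairPath ω)).comp (continuous_id.min continuous_const)
  have hGm : ∀ u, Measurable[MeasurableSpace.comap (pairPast s) inferInstance] fun ω => G ω u := by
    intro u
    have hr : (min u (s : ℝ)).toNNReal ∈ Iic s := by
      have h := Real.toNNReal_le_toNNReal (min_le_right u (s : ℝ))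
      rwa [Real.toNNReal_coe] at h
    -- `G ω u = w₀ B_r(ω₁) + w₁ B_r(ω₂)`, `r = (min u s)⁺ ≤ s`, is read off `pairPast s ω`
    set g : (Iic s → ℝ) × (Iic s → ℝ) → Fin N → ℝ := fun q i =>
      (if i.val = 0 then Real.sqrt (2 * (pinnedChain ω₂ lam β γ).γ * T_L) else 0) * q.1 ⟨_, hr⟩ +
        (if i.val = N - 1 then Real.sqrt (2 * (pinnedChain ω₂ lam β γ).γ * T_R) else 0) * q.2 ⟨_, hr⟩
      with hg
    have hgm : Measurable g := by
      refine measurable_pi_iff.2 fun i => ?_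
      exact (((measurable_pi_apply _).comp measurable_fst).const_mul _).add
        (((measurable_pi_apply _).comp measurable_snd).const_mul _)
    have hfun : (fun ω => G ω u) = g ∘ pairPast s := by
      funext ω i
      simp only [hG, hg, Function.comp_apply, chainNoise_pairPath]
      rfl
    rw [hfun]
    exact hgm.comp (comap_measurable (pairPast s))
  have hflow := pinnedChain_measurable_chainFlow hω hl hβ hγ N
    (mΩ := MeasurableSpace.comap (pairPast s) inferInstance) (X := fun _ : WienerPair => x)
    measurable_const hGc hGm s
  -- the stopped noise drives the same flow on `[0, s]`
  have heq : (fun ω : WienerPair => (pinnedChain ω₂ lam β γ).solMap N T_L T_R s x (pairPath ω)) =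
      fun ω => (pinnedChain ω₂ lam β γ).chainFlow N x (G ω) s := by
    funext ω
    unfold OscillatorChain.solMap
    refine pinnedChain_chainFlow_congr hω hl hβ hγ N x (continuous_chainNoise _ _ _) (hGc ω)
      (fun u hu => ?_) ⟨s.coe_nonneg, le_rfl⟩
    simp only [hG, min_eq_left hu.2]
  rw [heq]
  exact hflow

/-- **The Chapman–Kolmogorov equation** `P_{s+t} = P_t ∘ P_s` for the transition kernels of the
pinned chain: the cocycle property of the pathwise flow through the shifted Brownian pair
(`pinnedChain_solMap_add_pairPath`), the measurability of `Φ_s(x, B)` with respect to the past, and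
the weak Markov property of the pair of independent Brownian motions
(`Literature.Probability.Process.lintegral_comp_pairShift_eq`: the shifted pair is independent of
the past and has the law of the pair). [cite: CuneoEckmannHairerReyBellet2018, §3 p. 7] -/
theorem pinnedChain_transitionKernel_add (s t : ℝ≥0) :
    (pinnedChain ω₂ lam β γ).transitionKernel N T_L T_R (s + t) =
      (pinnedChain ω₂ lam β γ).transitionKernel N T_L T_R t ∘ₖ
        (pinnedChain ω₂ lam β γ).transitionKernel N T_L T_R s := by
  classical
  refine Kernel.ext fun x => Measure.ext fun A hA => ?_
  -- the functional `G(y, w) = 1_A(Φ_t(y, w))` on `PhaseSpace × (raw pairs)`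
  set F : PhaseSpace N × WienerPair → PhaseSpace N := fun p =>
    (pinnedChain ω₂ lam β γ).solMap N T_L T_R t p.1 p.2 with hF
  have hFm : Measurable F := pinnedChain_measurable_solMap hω hl hβ hγ N T_L T_R t
  set G : PhaseSpace N × WienerPair → ℝ≥0∞ := (F ⁻¹' A).indicator 1 with hG
  have hGm : Measurable G := measurable_one.indicator (hFm hA)
  -- the past-measurable position at time `s`
  set ξ : WienerPair → PhaseSpace N := fun ω =>
    (pinnedChain ω₂ lam β γ).solMap N T_L T_R s x (pairPath ω) with hξ
  have hξF : Measurable[MeasurableSpace.comap (pairPast s) inferInstance] ξ :=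
    pinnedChain_measurable_comap_pairPast_solMap hω hl hβ hγ N T_L T_R s x
  -- left-hand side: the cocycle property
  have hL : (pinnedChain ω₂ lam β γ).transitionKernel N T_L T_R (s + t) x A =
      ∫⁻ ω, G (ξ ω, pairShift s ω) ∂wienerPair := by
    rw [pinnedChain_transitionKernel_apply' hω hl hβ hγ N T_L T_R (s + t) x hA,
      ← lintegral_indicator_one
        ((pinnedChain_measurable_solMap_pairPath_right hω hl hβ hγ N T_L T_R _ x) hA)]
    refine lintegral_congr fun ω => ?_
    simp only [hG, hF, hξ, Set.indicator_apply, Set.mem_preimage, NNReal.coe_add, Pi.one_apply]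
    rw [pinnedChain_solMap_add_pairPath hω hl hβ hγ N T_L T_R s t.coe_nonneg x ω]
  -- right-hand side: `∫ P_t(y, A) P_s(x, dy) = E[ E'[1_A(Φ_t(ξ, B'))] ]`
  have hR : ((pinnedChain ω₂ lam β γ).transitionKernel N T_L T_R t ∘ₖ
      (pinnedChain ω₂ lam β γ).transitionKernel N T_L T_R s) x A =
      ∫⁻ ω, ∫⁻ ω', G (ξ ω, pairPath ω') ∂wienerPair ∂wienerPair := by
    rw [Kernel.comp_apply' _ _ _ hA,
      pinnedChain_lintegral_transitionKernel hω hl hβ hγ N T_L T_R s x (Kernel.measurable_coe _ hA)]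
    refine lintegral_congr fun ω => ?_
    rw [pinnedChain_transitionKernel_apply' hω hl hβ hγ N T_L T_R t _ hA,
      ← lintegral_indicator_one
        ((pinnedChain_measurable_solMap_pairPath_right hω hl hβ hγ N T_L T_R _ _) hA)]
    refine lintegral_congr fun ω' => ?_
    simp only [hG, hF, hξ, Set.indicator_apply, Set.mem_preimage, Pi.one_apply]
  rw [hL, hR]
  exact lintegral_comp_pairShift_eq s hξF hGm

end ChapmanKolmogorov

end Literature.MathematicalPhysics.KineticTheory.HeatConduction
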